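import Summits.HubbardSuperconductivity.HubbardSuperconductivity.Theorems.LevyLogBootstrapDressHalfFilledDictionaryAssembly
import Summits.HubbardSuperconductivity.HubbardSuperconductivity.Theorems.LevyLogBootstrapDressHalfFilledDictionaryLocality
import HarnessLib

/-!
# Route `LevyLogBootstrap` / `AnisotropyChord`, crux `DressHalfFilled` (stmt-HubbardSuperconductivity-8148), stub 2
# `stub_plaquetteDictionary`: THE BODY OF THE STUB ON THE WINDOW `U ∈ [2, 4]`

Support file (`--supports stmt-HubbardSuperconductivity-8148`). The registered stub of the skeleton
`Cruxes/DressHalfFilled/Lines/birth.lean` reads `stub_plaquetteDictionary : ∀ U : ℝ, 0 < U → PlaquetteData U →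
PlaquetteDictionary U`. This file proves its BODY (both abbreviations written out verbatim — the skeleton's `def`s are not
importable) for every `U ∈ [2, 4]`:

  `plaquetteDictionary_of_window : U ∈ [2,4] → ⟨PlaquetteData U⟩ → ⟨PlaquetteDictionary U⟩`,

by `…DictionaryAssembly.dressHalfFilled_dictionaryOfKernel` (clauses (a)(b)(c)(e) + assembly modulo (d)) fed with
`…DictionaryLocality.dictionaryMap_kernel_clause` (clause (d) for `dictionaryMap M U`, `U ∈ [2,4]`, `J(U) ≠ 0` — and
`0 < J(U)` is part of (W1) of the plaquette data). The window is where the tree's identification of Kato's two-plaquette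
kernel with the one-bond hard-core boson table currently lives (`…KernelSymmetry`, from the certified uniqueness of the
plaquette ground states on `[2,4]`); the by-name close of the stub for ALL `U > 0` needs that identification from the
(W4) clauses of `PlaquetteData U` instead (same proofs, hypotheses in place of the window) — not in this file.

References: W.-F. Tsai, S. A. Kivelson, PRB 73 (2006) 214510, App. A (A1) [TsaiKivelson2006]; H. Yao, W.-F. Tsai,
S. A. Kivelson, PRB 76 (2007) 161104(R), eq. (2) [YaoTsaiKivelson2007]. No definition and no named fact is introduced.
-/

set_option linter.dupNamespace false

noncomputable section

namespace Summit.HubbardSuperconductivity.HubbardSuperconductivity.Theorems.LevyLogBootstrap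

open Matrix Finset Literature.MathematicalPhysics.QuantumLattice Literature.Probability.LatticeModels
open Literature.MathematicalPhysics.QuantumLattice.TorusPlaquette
open scoped ComplexOrder

set_option linter.style.longLine false in
/-- **The plaquette-boson dictionary on the window**: for `U ∈ [2, 4]`, the plaquette data `PlaquetteData U` (verbatim
body; only (W1)'s `0 < J` and (W3)–(W5) are used) imply the dictionary `PlaquetteDictionary U` (verbatim body) with
`Φ = TorusPlaquette.dictionaryMap M U`. [cite: TsaiKivelson2006, App. A (A1)] -/
theorem plaquetteDictionary_of_window (U : ℝ) (hU : U ∈ Set.Icc (2 : ℝ) 4)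
    (hPD : (0 < (plaquettePairCouplings U).J ∧ 0 ≤ (plaquettePairCouplings U).V ∧
      (plaquettePairCouplings U).V < 2 * (plaquettePairCouplings U).J) ∧
  0 < (plaquettePairCouplings U).c ∧
  (0 < (plaquettePairCouplings U).pairBinding ∧ 0 < (plaquettePairCouplings U).pairExclusion ∧
    ∀ n : ℕ, n ≤ 8 → n ≠ 2 → n ≠ 4 →
      (4 - (n : ℝ)) * groundEnergyAt plaquetteGraph 1 U 2 + ((n : ℝ) - 2) * groundEnergyAt plaquetteGraph 1 U 4 <
        2 * groundEnergyAt plaquetteGraph 1 U n) ∧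
  (∀ φ₁ φ₂ : Fock (Orb PlaquetteSite), IsGroundStateInSector (plaquetteHamiltonian U) 4 0 φ₁ →
    IsGroundStateInSector (plaquetteHamiltonian U) 4 0 φ₂ → ∃ a : ℂ, φ₂ = a • φ₁) ∧
  (∀ φ₁ φ₂ : Fock (Orb PlaquetteSite), IsGroundStateInSector (plaquetteHamiltonian U) 2 0 φ₁ →
    IsGroundStateInSector (plaquetteHamiltonian U) 2 0 φ₂ → ∃ a : ℂ, φ₂ = a • φ₁) ∧
  (∀ m : ℝ, m = 1 ∨ m = -1 ∨ m = 2 ∨ m = -2 →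
    (plaquetteHamiltonian U).minEnergyOn (szSector 4 0) < (plaquetteHamiltonian U).minEnergyOn (szSector 4 m)) ∧
  (∀ m : ℝ, m = 1 ∨ m = -1 →
    (plaquetteHamiltonian U).minEnergyOn (szSector 2 0) < (plaquetteHamiltonian U).minEnergyOn (szSector 2 m))) :
    ∀ (L M : ℕ) [NeZero L] [NeZero M], L = 2 * M → 8 ≤ L → 4 ∣ L →
    let C := plaquettePairCouplings U;
    let Hin := hamiltonian ((fermionTorusGraph 2 L) \ SimpleGraph.comap
      (fun x : FermionTorus 2 L => fun i : Fin 2 => ((ofLex x) i : ℕ) / 2) ⊤) 1 U;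
    let T := hamiltonian ((fermionTorusGraph 2 L) ⊓ SimpleGraph.comap
      (fun x : FermionTorus 2 L => fun i : Fin 2 => ((ofLex x) i : ℕ) / 2) ⊤) 1 0;
    let E₀ : ℕ → ℝ := fun Nb => ((M : ℝ) ^ 2 - (Nb : ℝ)) * C.E 0 + (Nb : ℝ) * C.E 2;
    ∃ Φ : Matrix (Finset (Orb (FermionTorus 2 L))) (TensorIndex (TorusSite 2 M) 2) ℂ,
      Φᴴ * Φ = 1 ∧
      (∀ Nb : ℕ, Nb ≤ M ^ 2 → ∀ φ : TensorIndex (TorusSite 2 M) 2 → ℂ,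
        φ ∈ spinZSector (Λ := TorusSite 2 M) 1 ((Nb : ℝ) - (M : ℝ) ^ 2 / 2) →
        Φ *ᵥ φ ∈ szSector (Λ := FermionTorus 2 L) (L ^ 2 - 2 * Nb) 0 ∧
        Hin *ᵥ (Φ *ᵥ φ) = ((E₀ Nb : ℝ) : ℂ) • (Φ *ᵥ φ)) ∧
      (∀ Nb : ℕ, Nb ≤ M ^ 2 →
        Hin.minEnergyOn (szSector (Λ := FermionTorus 2 L) (L ^ 2 - 2 * Nb) 0) = E₀ Nb ∧
        ∀ ψ : Fock (Orb (FermionTorus 2 L)), ψ ∈ szSector (Λ := FermionTorus 2 L) (L ^ 2 - 2 * Nb) 0 →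
          Hin *ᵥ ψ = ((E₀ Nb : ℝ) : ℂ) • ψ →
          ∃ φ : TensorIndex (TorusSite 2 M) 2 → ℂ,
            φ ∈ spinZSector (Λ := TorusSite 2 M) 1 ((Nb : ℝ) - (M : ℝ) ^ 2 / 2) ∧ ψ = Φ *ᵥ φ) ∧
      (∃ k : ℕ → ℝ, ∀ Nb : ℕ, Nb ≤ M ^ 2 → ∀ φ φ' : TensorIndex (TorusSite 2 M) 2 → ℂ,
        φ ∈ spinZSector (Λ := TorusSite 2 M) 1 ((Nb : ℝ) - (M : ℝ) ^ 2 / 2) →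
        φ' ∈ spinZSector (Λ := TorusSite 2 M) 1 ((Nb : ℝ) - (M : ℝ) ^ 2 / 2) →
        star (Φ *ᵥ φ') ⬝ᵥ ((T * reducedResolvent Hin (E₀ Nb) * T) *ᵥ (Φ *ᵥ φ)) =
          -(star φ' ⬝ᵥ ((((2 * C.J : ℝ) : ℂ) • xxzHamiltonian 1 (torusGraph 2 M) (-1) C.ΔEff +
            ((k Nb : ℝ) : ℂ) • 1) *ᵥ φ))) ∧
      Φᴴ * pairField dWaveFormFactor L * Φ = ((C.c : ℝ) : ℂ) • ∑ R : TorusSite 2 M, onSite R (spinRaise 1) := by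
  obtain ⟨⟨hJ, -, -⟩, -, ⟨-, -, hW3⟩, hW4a, hW4b, hW5a, hW5b⟩ := hPD
  exact dressHalfFilled_dictionaryOfKernel U hW3 hW4a hW4b hW5a hW5b
    (fun M _ hM4 _ => dictionaryMap_kernel_clause hU hJ.ne' (by omega))

end Summit.HubbardSuperconductivity.HubbardSuperconductivity.Theorems.LevyLogBootstrap

end
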